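import Summits.AtomisticToContinuum.HydrodynamicLimit.Theorems.OneFlightGossipEngineEquilibriumClampedCollisionalWindowLDDefs
import Summits.AtomisticToContinuum.HydrodynamicLimit.Theorems.AntiMazurCoboundariesShearStressHalfDrudeMarginal
import Summits.AtomisticToContinuum.HydrodynamicLimit.Theorems.JParityClosureOddContactSymmetryGibbsInvariance
import Summits.AtomisticToContinuum.HydrodynamicLimit.Theorems.JaynesSqueezeBlockGibbsGaussianMoments
import Literature.MathematicalPhysics.KineticTheory.HardSphereUniformGas
import Literature.MathematicalPhysics.KineticTheory.HardSphereWindowPressureStatic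
import Literature.Analysis.FunctionSpaces.TorusCalculusProofs

/-!
# Mean zero of the EOS projection `Arow` under the Gibbs law (line `coarse-coin-entropy-chain`, W3)
(crux `EquilibriumClampedCollisionalWindowLD`, stmt-AtomisticToContinuum-13733; statics half — registered stubs
`gibbs_integral_sum_comp_pos`, `gibbs_integral_sum_pos_mul_vel` (one-body anchors) and `gibbs_integral_Arow` (H3))

Support file (`--supports stmt-AtomisticToContinuum-13733`) in the vocabulary of
`Theorems/OneFlightGossipEngineEquilibriumClampedCollisionalWindowLDDefs` (namespace
`Summit.AtomisticToContinuum.HydrodynamicLimit.Theorems.ClampedTransferCoin`: `Flow`, `Phase`, `gibbs`, `window`, `Arow`).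
`G_N = gibbs σ a₀ θ₀ u₀ N Φ` is the homogeneous (constant-profile) local Gibbs law of `N + 1` hard spheres on `𝕋³`;
for `σ ≤ 1/2`, `a₀, θ₀ > 0` it is a probability measure.

* **One-body statics.** The one-point position marginal of `G_N` is UNIFORM: `E_G[f(x_i)] = ∫_{𝕋³} f`
  (`gibbs_integral_comp_pos`; the factorisation `E_G[ψ(x_i) K] = (∫ψ) E_G[K]` of translation-invariant `K`,
  `ShearStressHalfDrudeMarginal.integral_mul_eq_integral_mul_of_posShift`, with `K = 1`), and the velocity of each particle
  is `N(u₀, θ₀ id) = gaussMeasure u₀ θ₀`, independently of the positions (`measurePreserving_vel_gibbs`, from the rung-0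
  product structure `localGibbsMeasure_rung0_eq_map`).  Hence `E_G[Σ_i f(x_i)] = (N+1) ∫ f`
  (`gibbs_integral_sum_comp_pos`) and `E_G[Σ_i f(x_i) g(v_i)] = (N+1) (∫ f) (∫ g dN(u₀, θ₀))` with integrability
  (`gibbs_integral_sum_pos_mul_vel`), for continuous `f` and continuous `N(u₀, θ₀)`-integrable `g`.
* **Window functionals.** For a measurable `G_N`-integrable observable `F` and a window `w > 0`,
  `z ↦ ∫₀ʷ F(Φ_r z) dr` is `G_N`-integrable with mean `w · E_G[F]` (`gibbs_window_integral`: joint measurability of the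
  torus flow on its good set, Tonelli, and stationarity `(Φ_r)_# G_N = G_N`, `measurePreserving_flow_localGibbsLaw_const`).
* **`E_G[A_r] = 0` in every row** (`gibbs_integral_Arow`): the EOS projection `A_r` of the crux is the window functional of
  a one-body observable `Σ_i f(x_i) g(v_i)` (momentum row `k`: `f = ∂_kφ`; energy row: `f = Σ_l u₀_l ∂_lφ`, plus the thermal
  term `θ₀(Z−1) Σ_l ∂_lφ(x_i)(v_i − u₀)_l`), each with `∫_{𝕋³} f = 0` (`Torus.integral_partialDeriv_eq_zero_holds`) and a
  Gaussian-integrable velocity factor (`‖v − u₀‖²`: `BlockGibbsLine.integrable_norm_sub_sq_gaussMeasure`; `(v − u₀)_l`: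
  `memLp_coord_gaussMeasure`).

Sources: H. Spohn, *Large Scale Dynamics of Interacting Particles* (1991), Part I §2.3 (homogeneous equilibrium measures,
stationarity); L. C. Evans, *Partial Differential Equations* (2010), App. C.2 Thm. 1 (`∫_{𝕋³} ∂_kφ = 0`).
prover-line-stmt-AtomisticToContinuum-13733-c4-0, 2026-08-16.
-/

noncomputable section

open MeasureTheory ProbabilityTheory Set Filter
open scoped ENNReal BigOperators
open Literature.Analysis.FluidPDE Literature.MathematicalPhysics.KineticTheory
open Literature.Analysis.FunctionSpaces (Torus.partialDeriv Torus.IsSmooth)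

namespace Summit.AtomisticToContinuum.HydrodynamicLimit.Theorems.ClampedTransferCoin

section OneBody

variable {σ a₀ θ₀ : ℝ}

/-- The homogeneous Gibbs law is a probability measure (`σ ≤ 1/2`, `a₀, θ₀ > 0`). -/
theorem isProbabilityMeasure_gibbs (hσ2 : σ ≤ 1 / 2) (ha : 0 < a₀) (hθ : 0 < θ₀) (u₀ : V3) (N : ℕ)
    (Φ : Flow σ N) : IsProbabilityMeasure (gibbs σ a₀ θ₀ u₀ N Φ) :=
  isProbabilityMeasure_localGibbsLaw continuous_const continuous_const continuous_const
    (fun _ => ha) (fun _ => hθ) hσ2 N Φ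

/-- **Uniform one-point position marginal**: `E_G[f(x_i)] = ∫_{𝕋³} f` for continuous `f`. -/
theorem gibbs_integral_comp_pos (hσ2 : σ ≤ 1 / 2) (ha : 0 < a₀) (hθ : 0 < θ₀) (u₀ : V3) (N : ℕ)
    (Φ : Flow σ N) {f : T3 → ℝ} (hf : Continuous f) (i : Fin (N + 1)) :
    ∫ z, f (z i).1 ∂(gibbs σ a₀ θ₀ u₀ N Φ) = ∫ x, f x := by
  haveI := isProbabilityMeasure_gibbs hσ2 ha hθ u₀ N Φ
  obtain ⟨C, -, hC⟩ := exists_forall_abs_le_of_continuous hf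
  have h := ShearStressHalfDrudeMarginal.integral_mul_eq_integral_mul_of_posShift σ a₀ θ₀ u₀ N Φ
    (K := fun _ => (1 : ℝ)) (integrable_const 1) (fun _ _ => rfl) hf.measurable hC i
  simpa only [mul_one, integral_const, probReal_univ, smul_eq_mul, one_mul] using h

/-- A continuous one-body position observable is `G_N`-integrable. -/
theorem gibbs_integrable_comp_pos (hσ2 : σ ≤ 1 / 2) (ha : 0 < a₀) (hθ : 0 < θ₀) (u₀ : V3) (N : ℕ)
    (Φ : Flow σ N) {f : T3 → ℝ} (hf : Continuous f) (i : Fin (N + 1)) :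
    Integrable (fun z : Phase N => f (z i).1) (gibbs σ a₀ θ₀ u₀ N Φ) := by
  haveI := isProbabilityMeasure_gibbs hσ2 ha hθ u₀ N Φ
  obtain ⟨C, -, hC⟩ := exists_forall_abs_le_of_continuous hf
  exact Integrable.of_bound (hf.measurable.comp (measurable_pi_apply i).fst).aestronglyMeasurable C
    (ae_of_all _ fun z => by rw [Real.norm_eq_abs]; exact hC _)

/-- **Maxwellian one-point velocity marginal**: the velocity of particle `i` pushes `G_N` forward to
`N(u₀, θ₀ id) = gaussMeasure u₀ θ₀` (rung-0 product structure `localGibbsMeasure_rung0_eq_map`; the configurational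
Gibbs measure has mass one for `σ ≤ 1/2`). -/
theorem measurePreserving_vel_gibbs (hσ2 : σ ≤ 1 / 2) (ha : 0 < a₀) (hθ : 0 < θ₀) (u₀ : V3) (N : ℕ)
    (Φ : Flow σ N) (i : Fin (N + 1)) :
    MeasurePreserving (fun z : Phase N => (z i).2) (gibbs σ a₀ θ₀ u₀ N Φ) (gaussMeasure u₀ θ₀) := by
  haveI := isProbabilityMeasure_posGibbsMeasure (a₀ := fun _ : T3 => a₀) continuous_const (fun _ => ha) hσ2 N
  have hm : Measurable fun z : Phase N => fun j => (z j).2 :=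
    measurable_pi_lambda _ fun j => (measurable_pi_apply j).snd
  have hvel : MeasurePreserving (fun z : Phase N => fun j => (z j).2) (gibbs σ a₀ θ₀ u₀ N Φ)
      (Measure.pi fun _ : Fin (N + 1) => gaussMeasure u₀ θ₀) := by
    refine ⟨hm, ?_⟩
    unfold gibbs
    rw [localGibbsLaw_eq, localGibbsMeasure_rung0_eq_map σ ha.le hθ u₀ N, Measure.map_map hm measurable_zipConfig]
    have hcomp : ((fun z : Phase N => fun j => (z j).2) ∘ zipConfig) =
        (Prod.snd : (Fin (N + 1) → T3) × (Fin (N + 1) → V3) → (Fin (N + 1) → V3)) := by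
      funext p j
      rfl
    rw [hcomp, Measure.map_snd_prod, measure_univ, one_smul]
  exact (measurePreserving_eval (fun _ : Fin (N + 1) => gaussMeasure u₀ θ₀) i).comp hvel

/-- One-body velocity observables: `G_N`-integrability is `N(u₀, θ₀)`-integrability. -/
theorem gibbs_integrable_comp_vel (hσ2 : σ ≤ 1 / 2) (ha : 0 < a₀) (hθ : 0 < θ₀) (u₀ : V3) (N : ℕ)
    (Φ : Flow σ N) {g : V3 → ℝ} (hgi : Integrable g (gaussMeasure u₀ θ₀)) (i : Fin (N + 1)) :
    Integrable (fun z : Phase N => g (z i).2) (gibbs σ a₀ θ₀ u₀ N Φ) :=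
  ((measurePreserving_vel_gibbs hσ2 ha hθ u₀ N Φ i).integrable_comp hgi.aestronglyMeasurable).2 hgi

/-- One-body velocity observables: `E_G[g(v_i)] = ∫ g dN(u₀, θ₀)`. -/
theorem gibbs_integral_comp_vel (hσ2 : σ ≤ 1 / 2) (ha : 0 < a₀) (hθ : 0 < θ₀) (u₀ : V3) (N : ℕ)
    (Φ : Flow σ N) {g : V3 → ℝ} (hg : AEStronglyMeasurable g (gaussMeasure u₀ θ₀)) (i : Fin (N + 1)) :
    ∫ z, g (z i).2 ∂(gibbs σ a₀ θ₀ u₀ N Φ) = ∫ v, g v ∂(gaussMeasure u₀ θ₀) := by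
  have h := measurePreserving_vel_gibbs hσ2 ha hθ u₀ N Φ i
  have hg' : AEStronglyMeasurable g ((gibbs σ a₀ θ₀ u₀ N Φ).map fun z : Phase N => (z i).2) := by
    rw [h.map_eq]
    exact hg
  rw [← integral_map (measurable_pi_apply i).snd.aemeasurable hg', h.map_eq]

/-- **Position × velocity factorisation, one particle**: for continuous `f` and continuous `N(u₀, θ₀)`-integrable
`g`, `f(x_i) g(v_i)` is `G_N`-integrable with mean `(∫ f)(∫ g dN(u₀, θ₀))` (uniform position marginal against the
translation-invariant `K = g(v_i)`). -/
theorem gibbs_integral_pos_mul_vel (hσ2 : σ ≤ 1 / 2) (ha : 0 < a₀) (hθ : 0 < θ₀) (u₀ : V3) (N : ℕ)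
    (Φ : Flow σ N) {f : T3 → ℝ} (hf : Continuous f) {g : V3 → ℝ} (hg : Continuous g)
    (hgi : Integrable g (gaussMeasure u₀ θ₀)) (i : Fin (N + 1)) :
    Integrable (fun z : Phase N => f (z i).1 * g (z i).2) (gibbs σ a₀ θ₀ u₀ N Φ) ∧
      ∫ z, f (z i).1 * g (z i).2 ∂(gibbs σ a₀ θ₀ u₀ N Φ) = (∫ x, f x) * ∫ v, g v ∂(gaussMeasure u₀ θ₀) := by
  obtain ⟨C, -, hC⟩ := exists_forall_abs_le_of_continuous hf
  have hgi' := gibbs_integrable_comp_vel hσ2 ha hθ u₀ N Φ hgi i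
  have hfm : AEStronglyMeasurable (fun z : Phase N => f (z i).1) (gibbs σ a₀ θ₀ u₀ N Φ) :=
    (hf.measurable.comp (measurable_pi_apply i).fst).aestronglyMeasurable
  refine ⟨hgi'.bdd_mul (c := C) hfm (ae_of_all _ fun z => ?_), ?_⟩
  · rw [Real.norm_eq_abs]
    exact hC _
  · rw [ShearStressHalfDrudeMarginal.integral_mul_eq_integral_mul_of_posShift σ a₀ θ₀ u₀ N Φ hgi'
        (fun _ _ => rfl) hf.measurable hC i,
      gibbs_integral_comp_vel hσ2 ha hθ u₀ N Φ hg.aestronglyMeasurable i]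

/-- The coordinates of the peculiar velocity `(v − u₀)_l` are integrable under every `gaussMeasure u θ`. -/
theorem integrable_sub_apply_gaussMeasure (u u₀ : V3) (θ : ℝ) (l : Fin 3) :
    Integrable (fun v : V3 => (v - u₀) l) (gaussMeasure u θ) :=
  ((memLp_coord_gaussMeasure u θ l 1 (by simp)).integrable le_rfl).sub (integrable_const (u₀ l))

end OneBody

/-! ### The two registered one-body anchors -/

/-- **Registered anchor `gibbs_integral_sum_comp_pos`.** `E_G[Σ_i f(x_i)] = (N+1) ∫_{𝕋³} f` for continuous `f`:
the one-point position marginal of the homogeneous Gibbs law is uniform. -/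
theorem gibbs_integral_sum_comp_pos {σ : ℝ} (hσ : 0 < σ) (hσ2 : σ < 1 / 2) {a₀ θ₀ : ℝ} (ha : 0 < a₀)
    (hθ : 0 < θ₀) (u₀ : V3) (N : ℕ) (Φ : Flow σ N) {f : T3 → ℝ} (hf : Continuous f) :
    ∫ z, (∑ i, f (z i).1) ∂(gibbs σ a₀ θ₀ u₀ N Φ) = ((N : ℝ) + 1) * ∫ x, f x := by
  have _ := hσ
  rw [integral_finsetSum _ fun i _ => gibbs_integrable_comp_pos hσ2.le ha hθ u₀ N Φ hf i]
  simp only [gibbs_integral_comp_pos hσ2.le ha hθ u₀ N Φ hf, Finset.sum_const, Finset.card_univ,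
    Fintype.card_fin, nsmul_eq_mul, Nat.cast_add, Nat.cast_one]

/-- **Registered anchor `gibbs_integral_sum_pos_mul_vel`.** For continuous `f` and continuous `N(u₀, θ₀)`-integrable
`g`, `Σ_i f(x_i) g(v_i)` is `G_N`-integrable with `E_G[Σ_i f(x_i) g(v_i)] = (N+1) (∫ f) (∫ g dN(u₀, θ₀))`: uniform
positions, and given the positions i.i.d. Maxwellian velocities. -/
theorem gibbs_integral_sum_pos_mul_vel {σ : ℝ} (hσ : 0 < σ) (hσ2 : σ < 1 / 2) {a₀ θ₀ : ℝ} (ha : 0 < a₀)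
    (hθ : 0 < θ₀) (u₀ : V3) (N : ℕ) (Φ : Flow σ N) {f : T3 → ℝ} (hf : Continuous f) {g : V3 → ℝ}
    (hg : Continuous g) (hgi : Integrable g (gaussMeasure u₀ θ₀)) :
    Integrable (fun z : Phase N => ∑ i, f (z i).1 * g (z i).2) (gibbs σ a₀ θ₀ u₀ N Φ) ∧
    ∫ z, (∑ i, f (z i).1 * g (z i).2) ∂(gibbs σ a₀ θ₀ u₀ N Φ) =
      ((N : ℝ) + 1) * ((∫ x, f x) * ∫ v, g v ∂(gaussMeasure u₀ θ₀)) := by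
  have _ := hσ
  have h := fun i => gibbs_integral_pos_mul_vel hσ2.le ha hθ u₀ N Φ hf hg hgi i
  refine ⟨integrable_finsetSum _ fun i _ => (h i).1, ?_⟩
  rw [integral_finsetSum _ fun i _ => (h i).1]
  simp only [(h _).2, Finset.sum_const, Finset.card_univ, Fintype.card_fin, nsmul_eq_mul, Nat.cast_add,
    Nat.cast_one]

/-! ### Window functionals under the stationary Gibbs law -/

/-- **Fubini + stationarity for window functionals.** For a measurable `G_N`-integrable observable `F` and `w > 0`,
`z ↦ ∫₀ʷ F(Φ_r z) dr` is `G_N`-integrable and `E_G[∫₀ʷ F(Φ_r z) dr] = w · E_G[F]` (the law is carried by the good set,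
on which the flow is jointly measurable; Tonelli and `(Φ_r)_# G_N = G_N` give integrability on `Phase × (0, w]`, then
Fubini and stationarity again). -/
theorem gibbs_window_integral {σ : ℝ} (a₀ θ₀ : ℝ) (u₀ : V3) (N : ℕ) (Φ : Flow σ N) {F : Phase N → ℝ}
    (hF : Measurable F) (hFi : Integrable F (gibbs σ a₀ θ₀ u₀ N Φ)) {w : ℝ} (hw : 0 < w) :
    Integrable (fun z => ∫ r in (0 : ℝ)..w, F (Φ.flow r z)) (gibbs σ a₀ θ₀ u₀ N Φ) ∧
      ∫ z, (∫ r in (0 : ℝ)..w, F (Φ.flow r z)) ∂(gibbs σ a₀ θ₀ u₀ N Φ) =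
        w * ∫ z, F z ∂(gibbs σ a₀ θ₀ u₀ N Φ) := by
  -- adapted from `KineticCurrentsWindowTilt.integral_window_eq_of_integrable`
  -- (`Theorems/KineticCurrentsWindowLDUniform/Negative/WindowFubini.lean`), keeping the integrability
  set μ := gibbs σ a₀ θ₀ u₀ N Φ with hμ
  haveI : SFinite μ := ShearStressHalfDrudeMarginal.sFinite_localGibbsLaw σ _ _ _ N Φ
  set ν : Measure ℝ := volume.restrict (Ioc (0 : ℝ) w) with hν
  haveI : IsFiniteMeasure ν := by
    rw [hν]
    exact isFiniteMeasure_restrict.2 (by simp)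
  have hgood : μ Φ.goodᶜ = 0 := localGibbsLaw_absolutelyContinuous σ _ _ _ N Φ Φ.measure_compl_good
  have hstat : ∀ t : ℝ, MeasurePreserving (Φ.flow t) μ μ := fun t =>
    measurePreserving_flow_localGibbsLaw_const σ a₀ θ₀ u₀ N Φ t
  -- joint a.e.-measurability and integrability on `Phase × (0, w]`
  have haem : AEMeasurable (fun p : Phase N × ℝ => F (Φ.flow p.2 p.1)) (μ.prod ν) :=
    Φ.aemeasurable_comp_flow_prod_torus hgood ν (0 : ℝ) hF
  have hint : Integrable (Function.uncurry fun (z : Phase N) (s : ℝ) => F (Φ.flow s z)) (μ.prod ν) := by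
    refine ⟨haem.aestronglyMeasurable, ?_⟩
    calc ∫⁻ p, ‖F (Φ.flow p.2 p.1)‖ₑ ∂(μ.prod ν)
        = ∫⁻ s, ∫⁻ z, ‖F (Φ.flow s z)‖ₑ ∂μ ∂ν := lintegral_prod_symm _ haem.enorm
      _ = ∫⁻ _s, ∫⁻ z, ‖F z‖ₑ ∂μ ∂ν := lintegral_congr fun s => (hstat s).lintegral_comp hF.enorm
      _ = (∫⁻ z, ‖F z‖ₑ ∂μ) * ν univ := lintegral_const _
      _ < ∞ := ENNReal.mul_lt_top hFi.2 (measure_lt_top _ _)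
  have hwin : ∀ z : Phase N, (∫ r in (0 : ℝ)..w, F (Φ.flow r z)) = ∫ s, F (Φ.flow s z) ∂ν := fun z =>
    intervalIntegral.integral_of_le hw.le
  simp_rw [hwin]
  refine ⟨hint.integral_prod_left, ?_⟩
  rw [integral_integral_swap hint]
  have hinv : ∀ s, ∫ z, F (Φ.flow s z) ∂μ = ∫ z, F z ∂μ := fun s =>
    integral_comp_flow_localGibbsLaw_const σ a₀ θ₀ u₀ N Φ s hF.aestronglyMeasurable
  simp_rw [hinv]
  rw [hν, setIntegral_const]
  simp [Measure.real, Real.volume_Ioc, hw.le]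

/-! ### The registered stub `gibbs_integral_Arow` -/

section Arow

variable {σ a₀ θ₀ : ℝ}

/-- The isotropic one-body term `f(x_i) · (θ₀σ³Z′ + ⅓(Z−1)‖v_i − u₀‖²)` with `∫ f = 0` is `G_N`-integrable with
mean zero. -/
theorem gibbs_integral_eosTerm (hσ2 : σ ≤ 1 / 2) (ha : 0 < a₀) (hθ : 0 < θ₀) (u₀ : V3) (N : ℕ)
    (Φ : Flow σ N) {f : T3 → ℝ} (hf : Continuous f) (hf0 : ∫ x, f x = 0) (i : Fin (N + 1)) :
    Integrable (fun y : Phase N => f (y i).1 *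
        (θ₀ * σ ^ 3 * deriv hsCompressibility (σ ^ 3) +
          (1 / 3) * (hsCompressibility (σ ^ 3) - 1) * ‖(y i).2 - u₀‖ ^ 2)) (gibbs σ a₀ θ₀ u₀ N Φ) ∧
      ∫ y, f (y i).1 *
        (θ₀ * σ ^ 3 * deriv hsCompressibility (σ ^ 3) +
          (1 / 3) * (hsCompressibility (σ ^ 3) - 1) * ‖(y i).2 - u₀‖ ^ 2) ∂(gibbs σ a₀ θ₀ u₀ N Φ) = 0 := by
  have hec : Continuous fun v : V3 => θ₀ * σ ^ 3 * deriv hsCompressibility (σ ^ 3) +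
      (1 / 3) * (hsCompressibility (σ ^ 3) - 1) * ‖v - u₀‖ ^ 2 := by
    fun_prop
  have hei : Integrable (fun v : V3 => θ₀ * σ ^ 3 * deriv hsCompressibility (σ ^ 3) +
      (1 / 3) * (hsCompressibility (σ ^ 3) - 1) * ‖v - u₀‖ ^ 2) (gaussMeasure u₀ θ₀) :=
    (integrable_const _).add ((BlockGibbsLine.integrable_norm_sub_sq_gaussMeasure u₀ u₀ θ₀).const_mul _)
  have h := gibbs_integral_pos_mul_vel hσ2 ha hθ u₀ N Φ hf hec hei i
  rw [hf0, zero_mul] at h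
  exact h

/-- The thermal one-body term `f(x_i) (v_i − u₀)_l` with `∫ f = 0` is `G_N`-integrable with mean zero. -/
theorem gibbs_integral_thermalTerm (hσ2 : σ ≤ 1 / 2) (ha : 0 < a₀) (hθ : 0 < θ₀) (u₀ : V3) (N : ℕ)
    (Φ : Flow σ N) {f : T3 → ℝ} (hf : Continuous f) (hf0 : ∫ x, f x = 0) (i : Fin (N + 1)) (l : Fin 3) :
    Integrable (fun y : Phase N => f (y i).1 * ((y i).2 - u₀) l) (gibbs σ a₀ θ₀ u₀ N Φ) ∧
      ∫ y, f (y i).1 * ((y i).2 - u₀) l ∂(gibbs σ a₀ θ₀ u₀ N Φ) = 0 := by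
  have hgc : Continuous fun v : V3 => (v - u₀) l :=
    (EuclideanSpace.proj (𝕜 := ℝ) l).continuous.comp (continuous_id.sub continuous_const)
  have h := gibbs_integral_pos_mul_vel hσ2 ha hθ u₀ N Φ hf hgc (integrable_sub_apply_gaussMeasure u₀ u₀ θ₀ l) i
  rw [hf0, zero_mul] at h
  exact h

/-- **Momentum rows**: the observable `Σ_i ∂_kφ(x_i) (θ₀σ³Z′ + ⅓(Z−1)‖v_i − u₀‖²)` is `G_N`-integrable with mean
zero (`∫_{𝕋³} ∂_kφ = 0`). -/
theorem gibbs_integral_ArowObs_some (hσ2 : σ ≤ 1 / 2) (ha : 0 < a₀) (hθ : 0 < θ₀) (u₀ : V3) {φ : T3 → ℝ}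
    (hφ : Torus.IsSmooth φ) (N : ℕ) (Φ : Flow σ N) (k : Fin 3) :
    Integrable (fun y : Phase N => ∑ i, Torus.partialDeriv k φ (y i).1 *
        (θ₀ * σ ^ 3 * deriv hsCompressibility (σ ^ 3) +
          (1 / 3) * (hsCompressibility (σ ^ 3) - 1) * ‖(y i).2 - u₀‖ ^ 2)) (gibbs σ a₀ θ₀ u₀ N Φ) ∧
      ∫ y, (∑ i, Torus.partialDeriv k φ (y i).1 *
        (θ₀ * σ ^ 3 * deriv hsCompressibility (σ ^ 3) +
          (1 / 3) * (hsCompressibility (σ ^ 3) - 1) * ‖(y i).2 - u₀‖ ^ 2)) ∂(gibbs σ a₀ θ₀ u₀ N Φ) = 0 := by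
  have h := fun i => gibbs_integral_eosTerm hσ2 ha hθ u₀ N Φ (hφ.partialDeriv k).continuous
    (Literature.Analysis.FunctionSpaces.Torus.integral_partialDeriv_eq_zero_holds hφ k) i
  refine ⟨integrable_finsetSum _ fun i _ => (h i).1, ?_⟩
  rw [integral_finsetSum _ fun i _ => (h i).1]
  exact Finset.sum_eq_zero fun i _ => (h i).2

/-- **Energy row**: the observable
`Σ_i ((Σ_l u₀_l ∂_lφ(x_i)) (θ₀σ³Z′ + ⅓(Z−1)‖v_i − u₀‖²) + θ₀(Z−1) Σ_l ∂_lφ(x_i)(v_i − u₀)_l)` is `G_N`-integrable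
with mean zero. -/
theorem gibbs_integral_ArowObs_none (hσ2 : σ ≤ 1 / 2) (ha : 0 < a₀) (hθ : 0 < θ₀) (u₀ : V3) {φ : T3 → ℝ}
    (hφ : Torus.IsSmooth φ) (N : ℕ) (Φ : Flow σ N) :
    Integrable (fun y : Phase N => ∑ i,
        ((∑ l, u₀ l * Torus.partialDeriv l φ (y i).1) *
            (θ₀ * σ ^ 3 * deriv hsCompressibility (σ ^ 3) +
              (1 / 3) * (hsCompressibility (σ ^ 3) - 1) * ‖(y i).2 - u₀‖ ^ 2) +
          θ₀ * (hsCompressibility (σ ^ 3) - 1) *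
            (∑ l, Torus.partialDeriv l φ (y i).1 * ((y i).2 - u₀) l))) (gibbs σ a₀ θ₀ u₀ N Φ) ∧
      ∫ y, (∑ i,
        ((∑ l, u₀ l * Torus.partialDeriv l φ (y i).1) *
            (θ₀ * σ ^ 3 * deriv hsCompressibility (σ ^ 3) +
              (1 / 3) * (hsCompressibility (σ ^ 3) - 1) * ‖(y i).2 - u₀‖ ^ 2) +
          θ₀ * (hsCompressibility (σ ^ 3) - 1) *
            (∑ l, Torus.partialDeriv l φ (y i).1 * ((y i).2 - u₀) l))) ∂(gibbs σ a₀ θ₀ u₀ N Φ) = 0 := by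
  have hdφc : ∀ l, Continuous (Torus.partialDeriv l φ) := fun l => (hφ.partialDeriv l).continuous
  have hdφ0 : ∀ l, ∫ x, Torus.partialDeriv l φ x = 0 := fun l =>
    Literature.Analysis.FunctionSpaces.Torus.integral_partialDeriv_eq_zero_holds hφ l
  have hf1c : Continuous fun x : T3 => ∑ l, u₀ l * Torus.partialDeriv l φ x :=
    continuous_finsetSum _ fun l _ => continuous_const.mul (hdφc l)
  have hf10 : ∫ x, (∑ l, u₀ l * Torus.partialDeriv l φ x) = 0 := by
    rw [integral_finsetSum _ fun l _ => ((hφ.partialDeriv l).integrable).const_mul _]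
    exact Finset.sum_eq_zero fun l _ => by rw [integral_const_mul, hdφ0 l, mul_zero]
  have hA := fun i => gibbs_integral_eosTerm hσ2 ha hθ u₀ N Φ hf1c hf10 i
  have hB := fun i l => gibbs_integral_thermalTerm hσ2 ha hθ u₀ N Φ (hdφc l) (hdφ0 l) i l
  have hBi : ∀ i, Integrable (fun y : Phase N => θ₀ * (hsCompressibility (σ ^ 3) - 1) *
      (∑ l, Torus.partialDeriv l φ (y i).1 * ((y i).2 - u₀) l)) (gibbs σ a₀ θ₀ u₀ N Φ) := fun i =>
    (integrable_finsetSum _ fun l _ => (hB i l).1).const_mul _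
  have hterm : ∀ i, Integrable (fun y : Phase N =>
      (∑ l, u₀ l * Torus.partialDeriv l φ (y i).1) *
          (θ₀ * σ ^ 3 * deriv hsCompressibility (σ ^ 3) +
            (1 / 3) * (hsCompressibility (σ ^ 3) - 1) * ‖(y i).2 - u₀‖ ^ 2) +
        θ₀ * (hsCompressibility (σ ^ 3) - 1) *
          (∑ l, Torus.partialDeriv l φ (y i).1 * ((y i).2 - u₀) l)) (gibbs σ a₀ θ₀ u₀ N Φ) := fun i =>
    (hA i).1.add (hBi i)
  refine ⟨integrable_finsetSum _ fun i _ => hterm i, ?_⟩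
  rw [integral_finsetSum _ fun i _ => hterm i]
  refine Finset.sum_eq_zero fun i _ => ?_
  rw [integral_add (hA i).1 (hBi i), (hA i).2, zero_add, integral_const_mul,
    integral_finsetSum _ fun l _ => (hB i l).1]
  rw [Finset.sum_eq_zero fun l _ => (hB i l).2, mul_zero]

end Arow

/-- **Registered stub `gibbs_integral_Arow` (H3).** Under the homogeneous Gibbs law the EOS projection `A_r` of the
crux is integrable with mean zero, in every row `r` (momentum rows `some k`, energy row `none`): `A_r` is the window
functional `∫₀ʷ F_r(Φ_s z) ds` of a one-body observable `F_r = Σ_i f(x_i) g(v_i)` (plus the thermal term in the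
energy row) with `∫_{𝕋³} f = 0`, so `E_G[A_r] = w · E_G[F_r] = w (N+1) (∫ f)(∫ g dN(u₀, θ₀)) = 0` by stationarity of
`G_N` under the flow, Fubini, the uniform position marginal and the Maxwellian velocity marginal. -/
theorem gibbs_integral_Arow {σ : ℝ} (hσ : 0 < σ) (hσ2 : σ < 1 / 2) {a₀ θ₀ : ℝ} (ha : 0 < a₀)
    (hθ : 0 < θ₀) (u₀ : V3) {τ : ℝ} (hτ : 0 < τ) {φ : T3 → ℝ} (hφ : Torus.IsSmooth φ) (N : ℕ)
    (Φ : Flow σ N) (r : Option (Fin 3)) :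
    Integrable (Arow σ θ₀ u₀ τ φ Φ r) (gibbs σ a₀ θ₀ u₀ N Φ) ∧
      ∫ z, Arow σ θ₀ u₀ τ φ Φ r z ∂(gibbs σ a₀ θ₀ u₀ N Φ) = 0 := by
  have _ := hσ
  have hdφc : ∀ l, Continuous (Torus.partialDeriv l φ) := fun l => (hφ.partialDeriv l).continuous
  have hec : Continuous fun v : V3 => θ₀ * σ ^ 3 * deriv hsCompressibility (σ ^ 3) +
      (1 / 3) * (hsCompressibility (σ ^ 3) - 1) * ‖v - u₀‖ ^ 2 := by
    fun_prop
  cases r with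
  | some k =>
    have hobs := gibbs_integral_ArowObs_some hσ2.le ha hθ u₀ hφ N Φ k
    have hFc : Continuous fun y : Phase N => ∑ i, Torus.partialDeriv k φ (y i).1 *
        (θ₀ * σ ^ 3 * deriv hsCompressibility (σ ^ 3) +
          (1 / 3) * (hsCompressibility (σ ^ 3) - 1) * ‖(y i).2 - u₀‖ ^ 2) :=
      continuous_finsetSum _ fun i _ =>
        ((hdφc k).comp (continuous_apply i).fst).mul (hec.comp (continuous_apply i).snd)
    have hW := gibbs_window_integral a₀ θ₀ u₀ N Φ hFc.measurable hobs.1 (window_pos hτ N)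
    rw [hobs.2, mul_zero] at hW
    exact hW
  | none =>
    have hobs := gibbs_integral_ArowObs_none hσ2.le ha hθ u₀ hφ N Φ
    have hFc : Continuous fun y : Phase N => ∑ i,
        ((∑ l, u₀ l * Torus.partialDeriv l φ (y i).1) *
            (θ₀ * σ ^ 3 * deriv hsCompressibility (σ ^ 3) +
              (1 / 3) * (hsCompressibility (σ ^ 3) - 1) * ‖(y i).2 - u₀‖ ^ 2) +
          θ₀ * (hsCompressibility (σ ^ 3) - 1) *
            (∑ l, Torus.partialDeriv l φ (y i).1 * ((y i).2 - u₀) l)) := by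
      refine continuous_finsetSum _ fun i _ => ?_
      have h1 : Continuous fun y : Phase N => (y i).1 := (continuous_apply i).fst
      have h2 : Continuous fun y : Phase N => (y i).2 := (continuous_apply i).snd
      exact ((continuous_finsetSum _ fun l _ => continuous_const.mul ((hdφc l).comp h1)).mul
        (hec.comp h2)).add (continuous_const.mul (continuous_finsetSum _ fun l _ =>
          ((hdφc l).comp h1).mul ((EuclideanSpace.proj (𝕜 := ℝ) l).continuous.comp (h2.sub continuous_const))))
    have hW := gibbs_window_integral a₀ θ₀ u₀ N Φ hFc.measurable hobs.1 (window_pos hτ N)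
    rw [hobs.2, mul_zero] at hW
    exact hW

end Summit.AtomisticToContinuum.HydrodynamicLimit.Theorems.ClampedTransferCoin

end
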